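import Literature.NumberTheory.Automorphic.PicardCMEigenbasisHolds
import Literature.AlgebraicGeometry.HodgeTheory.ComplexConjugationHolds
import Literature.AlgebraicGeometry.HodgeTheory.HodgeFiltrationModelsReductionProofs
import Literature.AlgebraicGeometry.ComplexMultiplication.CMAbelianVarietyRealisedHolds
import HarnessLib

/-!
# Discharged fact: every CM type is realised by a CM abelian variety with an eigenbasis of `H¹`
# adapted to the type (Shimura 1998, §3.2; record (iii) of the Picard/CM cluster)

`Literature.NumberTheory.Automorphic.PicardCM.CMAbelianVarietyEigenbasisRealised`
(`Automorphic/PicardCMEigenbasis`) was reduced in the tree to three facts that are all theorems now —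
the real Hodge model `exists_isReal_hodgeModel_holds` (`HodgeTheory/ComplexConjugationHolds`), the
model-independence of `H^{p,q}` `hodgePQ_independent_of_hodgeModel_holds`
(`HodgeTheory/HodgeFiltrationModelsReductionProofs`) and the realisation of CM types
`CMAbelianVarietyRealised_holds` (`ComplexMultiplication/CMAbelianVarietyRealisedHolds`) — by
`PicardCM.cmAbelianVarietyEigenbasisRealised_of_realised` (`Automorphic/PicardCMEigenbasisHolds`).
One-line application; no statement is changed; no definition, no new named fact (D-0026); net
Literature debt **−1**.

## References

* G. Shimura, *Abelian Varieties with Complex Multiplication and Modular Functions* (1998), §3.2,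
  pp. 19–20. [Shimura1998]
* C. Voisin, *Hodge Theory and Complex Algebraic Geometry I* (2002), §6.1.3, Cor. 6.12 and Cor. 6.14.
  [VoisinHodgeI2002]
-/

namespace Literature.NumberTheory.Automorphic

namespace PicardCM

/-- **Record (iii) of the Picard/CM cluster: CM types are realised with an adapted eigenbasis of `H¹`
— the named fact `CMAbelianVarietyEigenbasisRealised` holds**
(`cmAbelianVarietyEigenbasisRealised_of_realised` applied to `exists_isReal_hodgeModel_holds`,
`hodgePQ_independent_of_hodgeModel_holds` and `CMAbelianVarietyRealised_holds`).
[cite: Shimura1998, §3.2, pp. 19–20] [cite: VoisinHodgeI2002, §6.1.3 Cor. 6.12 and Cor. 6.14] -/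
theorem CMAbelianVarietyEigenbasisRealised_holds : CMAbelianVarietyEigenbasisRealised :=
  cmAbelianVarietyEigenbasisRealised_of_realised
    Literature.AlgebraicGeometry.HodgeTheory.exists_isReal_hodgeModel_holds
    Literature.AlgebraicGeometry.HodgeTheory.hodgePQ_independent_of_hodgeModel_holds
    CMAbelianVarietyRealised_holds

end PicardCM

end Literature.NumberTheory.Automorphic
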